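import Summits.Parity.BatemanHorn.Theorems.SoloInformedHooleyShiftHypothesis

/-!
# The shifted Hooley sum is the Hooley sum of a translate: `S^{(b)}_g(h;e) = S_{g(X+b)}(h;e)`

Informed soloist `solo-Parity-informed` (session 142, Q20), conjunct `BatemanHorn`, the `d ≥ 3` rung below the parity
wall.  The hypothesis `HooleyShiftUniform g η` of `SoloInformedHooleyShiftHypothesis` is stated with the SHIFTED sums
`S^{(b)}_g(h;e) = e(−hb/e)·S_g(h;e) = ∑_{ν root of g mod e} e(h(ν − b)/e)`.  Here we identify them with ordinary Hooley
sums of the TRANSLATED polynomial `g_b(X) = g(X + b)`, whose roots modulo `e` are the `ν − b`: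

* `hooleySumShift_eq_hooleySum_comp` — `hooleySumShift g e h b = hooleySum (g.comp (X + C b)) e h` for all `e, h, b`
  (an explicit bijection of root residues `ν ↦ (ν − b) mod e` and the periodicity of `e(·/e)`);
* (`h = 0` gives `ρ_{g(X+b)}(e) = ρ_g(e)`, already in the tree as `Literature.Barriers.Parity.polyRootCountMod_comp_X_add_C`;)
* `hooleyShiftUniform_iff_translate` — hence `HooleyShiftUniform g η` says exactly: ONE constant `C` with
  `‖∑_{E<e≤E'} S_{g(X+b)}(h;e)‖ ≤ C·E^{1−η}` for all dyadic `E ≤ E' ≤ 2E`, all frequencies `0 < |h| ≤ E` and all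
  translates `0 ≤ b ≤ 2E` — a power saving in Hooley's sums, uniform over the family of translates of `g`
  (same discriminant, same `ρ`, coefficients of size `≍ b^{deg g}`).

Elementary; no hypotheses.  References: C. Hooley, *On the number of divisors of a quadratic polynomial*, Acta Math. 110
(1963); *On the distribution of the roots of polynomial congruences*, Mathematika 11 (1964) — the sums `S_g(h;e)`.
-/

namespace Summit.Parity.BatemanHorn.Theorems

open Finset Polynomial

/-! ### Tools -/

/-- `e(hx/e) = e(hy/e)` when `e ∣ x − y`. [folklore] -/
theorem eAdd_mul_eq_of_dvd_sub {e : ℕ} {x y : ℤ} (hxy : (e : ℤ) ∣ x - y) (h : ℤ) :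
    eAdd e (h * x) = eAdd e (h * y) := by
  obtain ⟨t, ht⟩ := hxy
  have : h * x = h * y + e * (h * t) := by linear_combination h * ht
  rw [this, eAdd_add_modulus_mul]

/-! ### The translate identity -/

/-- The roots of `g(X + b)` modulo `e`: `μ` with `e ∣ g(μ + b)`. [folklore] -/
theorem mem_rootResidues_comp {g : ℤ[X]} {b : ℤ} {e μ : ℕ} :
    μ ∈ rootResidues (g.comp (X + C b)) e ↔ μ < e ∧ (e : ℤ) ∣ g.eval ((μ : ℤ) + b) := by
  rw [mem_rootResidues, eval_comp, eval_add, eval_X, eval_C]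

/-- **`S^{(b)}_g(h;e) = S_{g(X+b)}(h;e)`**: the shifted Hooley sum is the Hooley sum of the translate. [this work] -/
theorem hooleySumShift_eq_hooleySum_comp (g : ℤ[X]) (e : ℕ) (h b : ℤ) :
    hooleySumShift g e h b = hooleySum (g.comp (X + C b)) e h := by
  rcases Nat.eq_zero_or_pos e with rfl | he
  · -- no residues modulo `0` in `range 0`
    simp [hooleySumShift, hooleySum, rootResidues]
  -- the representative `c ∈ [0, e)` of `−b`, and its complement `e − c`
  set c : ℕ := ((-b) % (e : ℤ)).toNat with hc
  have he0 : (e : ℤ) ≠ 0 := by exact_mod_cast he.ne'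
  have hcZ : (c : ℤ) = (-b) % (e : ℤ) := by rw [hc, Int.toNat_of_nonneg (Int.emod_nonneg _ he0)]
  have hce : c < e := by
    have : (c : ℤ) < e := by rw [hcZ]; exact Int.emod_lt_of_pos _ (by exact_mod_cast he)
    exact_mod_cast this
  have hcb : (e : ℤ) ∣ (c : ℤ) + b := ⟨-((-b) / (e : ℤ)), by rw [hcZ, Int.emod_def]; ring⟩
  -- two folklore facts (the first is a private lemma of `Literature…PrimePowerCongruenceRoots`):
  -- congruent arguments give congruent values, and `(m % e) − m` is a multiple of `e`
  have hcongr : ∀ {x y : ℤ}, (e : ℤ) ∣ x - y → ((e : ℤ) ∣ g.eval x ↔ (e : ℤ) ∣ g.eval y) := by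
    intro x y hxy
    have hg : (e : ℤ) ∣ g.eval x - g.eval y := dvd_trans hxy (Polynomial.sub_dvd_eval_sub x y g)
    constructor
    · intro hx
      have := dvd_sub hx hg
      rwa [sub_sub_cancel] at this
    · intro hy
      have := dvd_add hg hy
      rwa [sub_add_cancel] at this
  have hmodsub : ∀ m : ℕ, (e : ℤ) ∣ ((m % e : ℕ) : ℤ) - (m : ℤ) := by
    intro m
    refine ⟨-((m / e : ℕ) : ℤ), ?_⟩
    have h' : ((m % e : ℕ) : ℤ) + (e : ℤ) * ((m / e : ℕ) : ℤ) = m := by exact_mod_cast Nat.mod_add_div m e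
    linear_combination h'
  -- the maps
  set φ : ℕ → ℕ := fun ν => (ν + c) % e with hφ
  set ψ : ℕ → ℕ := fun μ => (μ + (e - c)) % e with hψ
  -- congruences `φ ν + b ≡ ν`, `ψ μ ≡ μ + b` (mod e)
  have hφcong : ∀ ν : ℕ, (e : ℤ) ∣ ((φ ν : ℤ) + b) - (ν : ℤ) := by
    intro ν
    have h1 := hmodsub (ν + c)
    have : ((φ ν : ℤ) + b) - (ν : ℤ) = (((((ν + c) % e : ℕ) : ℤ) - ((ν + c : ℕ) : ℤ))) + ((c : ℤ) + b) := by
      simp only [hφ]; push_cast; ring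
    rw [this]
    exact dvd_add h1 hcb
  have hψcong : ∀ μ : ℕ, (e : ℤ) ∣ (ψ μ : ℤ) - ((μ : ℤ) + b) := by
    intro μ
    have h1 := hmodsub (μ + (e - c))
    have hec : ((e - c : ℕ) : ℤ) = (e : ℤ) - c := by push_cast [Nat.cast_sub hce.le]; ring
    have : (ψ μ : ℤ) - ((μ : ℤ) + b)
        = ((((μ + (e - c)) % e : ℕ) : ℤ) - ((μ + (e - c) : ℕ) : ℤ)) + (e : ℤ) - ((c : ℤ) + b) := by
      simp only [hψ]; push_cast [Nat.cast_sub hce.le]; ring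
    rw [this]
    exact dvd_sub (dvd_add h1 (dvd_refl _)) hcb
  rw [hooleySumShift, hooleySum, hooleySum, mul_sum]
  refine sum_nbij' φ ψ ?_ ?_ ?_ ?_ ?_
  · -- `φ` maps roots of `g` to roots of the translate
    intro ν hν
    rw [mem_rootResidues] at hν
    rw [mem_rootResidues_comp]
    exact ⟨Nat.mod_lt _ he, (hcongr (hφcong ν)).mpr hν.2⟩
  · -- `ψ` maps back
    intro μ hμ
    rw [mem_rootResidues_comp] at hμ
    rw [mem_rootResidues]
    exact ⟨Nat.mod_lt _ he, (hcongr (hψcong μ)).mpr hμ.2⟩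
  · -- `ψ ∘ φ = id` on residues
    intro ν hν
    rw [mem_rootResidues] at hν
    show ((ν + c) % e + (e - c)) % e = ν
    rw [Nat.add_mod, Nat.mod_mod, ← Nat.add_mod, show ν + c + (e - c) = ν + e by omega, Nat.add_mod_right,
      Nat.mod_eq_of_lt hν.1]
  · -- `φ ∘ ψ = id` on residues
    intro μ hμ
    rw [mem_rootResidues_comp] at hμ
    show ((μ + (e - c)) % e + c) % e = μ
    rw [Nat.add_mod, Nat.mod_mod, ← Nat.add_mod, show μ + (e - c) + c = μ + e by omega, Nat.add_mod_right,
      Nat.mod_eq_of_lt hμ.1]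
  · -- the summands agree: `e(−hb/e)e(hν/e) = e(h(ν−b)/e) = e(h·φ(ν)/e)`
    intro ν _
    rw [← eAdd_add, show -(h * b) + h * ν = h * ((ν : ℤ) - b) by ring]
    refine eAdd_mul_eq_of_dvd_sub ?_ h
    have := hφcong ν
    rw [show ((φ ν : ℤ) + b) - ν = -(((ν : ℤ) - b) - (φ ν : ℤ)) by ring, dvd_neg] at this
    exact this

/-- `S^{(b)}_g(0;e) = S_g(0;e)` (frequency zero). [folklore] -/
theorem hooleySumShift_freq_zero (g : ℤ[X]) (e : ℕ) (b : ℤ) : hooleySumShift g e 0 b = hooleySum g e 0 := by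
  rw [hooleySumShift, zero_mul, neg_zero, eAdd_zero, one_mul]

/-- **The hypothesis in translate form.**  `HooleyShiftUniform g η` ⟺ one constant `C` with
`‖∑_{E<e≤E'} S_{g(X+b)}(h;e)‖ ≤ C·E^{1−η}` for all dyadic ranges, all `0 < |h| ≤ E`, all translates `0 ≤ b ≤ 2E`. [this work] -/
theorem hooleyShiftUniform_iff_translate (g : ℤ[X]) (η : ℝ) :
    HooleyShiftUniform g η ↔
      ∃ C : ℝ, ∀ (h b : ℤ) (E E' : ℕ), h ≠ 0 → 1 ≤ E → E ≤ E' → E' ≤ 2 * E → |h| ≤ E → 0 ≤ b → b ≤ 2 * E →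
        ‖∑ e ∈ Ioc E E', hooleySum (g.comp (X + Polynomial.C b)) e h‖ ≤ C * (E : ℝ) ^ (1 - η) := by
  unfold HooleyShiftUniform
  simp only [hooleySumShift_eq_hooleySum_comp]

end Summit.Parity.BatemanHorn.Theorems
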